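import Summits.RiemannHypothesis.RiemannHypothesis.Theorems.HandoffBottomCriterion
import Summits.RiemannHypothesis.RiemannHypothesis.Theorems.HandoffLossyStep
import Summits.RiemannHypothesis.RiemannHypothesis.Theorems.SoloInformedQuasiWeilExact
import HarnessLib

/-!
# DISCHARGE of the handoff track's «open criterion»: `WeilBottomBoundedCriterion` and LEMMA L are tree theorems

Cell `rh-explicit`, TRACK «HANDOFF», seat handoff-theory-1 (definitions + logic), gen4.  Companion text:
`HOME/handoff/HANDOFF-STATEMENT.md` §J.10.

WHAT HAPPENED.  Files I/II/V of this seat (`HandoffLossyCoupling.lean`, `HandoffLossyStep.lean`,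
`HandoffBottomCriterion.lean`, gen3) isolated ONE analytic input for the lossy tier of the handoff logic and labelled it
OPEN: `WeilBottomBoundedCriterion := (∃ C, ∀ t > 0, −C ≤ ε t) → RH` (`ε = weilGroundEnergy`, the Weil window bottom),
equivalently (`weilBottomBoundedCriterion_iff_dropOfOffLineZero`) the Lemma-L shape `WeilBottomDropOfOffLineZero`.  Three
planner seats then proved it on paper (idea-1 LEMMA L, idea-2 L10′, handoff-lit J4-LIT-NOTE), and theory-2 began a kernel
proof by Landau's method.  A presearch of the `weilGroundEnergy` API (this seat, gen4, 2026-08-23) shows the criterion —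
and its GRADED form — were ALREADY KERNEL THEOREMS of the tree, landed by other programmes:
* route `WeilGroundState` (crux `GroundStatesConvergeToXi`, sub-goal (E)):
  `GroundStatesConvergeToXi.riemannHypothesis_of_weilGroundEnergy_bddBelow` /
  `GroundStatesConvergeToXi.riemannHypothesis_iff_weilGroundEnergy_bddBelow` — ZERO side: Bombieri's translation–polarisation
  converse (`WeilCriterionConverse.lean`) run with slack, plus bounded generalised Dirichlet series
  (`Literature.Analysis.Complex.BoundedPowerSum`);
* the Solo programme `solo-RiemannHypothesis-informed` (`SoloInformedQuasiWeil*.lean`): the SHARP graded form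
  `abs_re_sub_half_le_of_weilGroundEnergy_exp_lower` («`ε(a) ≥ −Ce^{κa}` for `a ≥ a₀` ⟹ `|Re ρ − ½| ≤ κ/2`», centred
  dipoles), its Ω-form `frequently_weilGroundEnergy_lt_of_offline_zero`, `riemannHypothesis_iff_weilGroundEnergy_subexp`,
  `riemannHypothesis_iff_weilGroundEnergy_bddBelow`, `weilGroundEnergy_dichotomy`, the unconditional floor
  `weilGroundEnergy_ge_neg_exp`, and the converse half in the Sobolev normalisation (`width_iff_weilQuadratic_sobolev_subexp`,
  the «exact thermometer»).

WHAT THIS FILE DOES (bridges only; every proof is a few lines on top of the tree theorems):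
* `weilBottomBoundedCriterion_holds`, `weilBottomDropOfOffLineZero_holds` — the gen3 Props HOLD;
* `weilBottomExpDrop_of_zero` — the GRADED Ω-statement in exactly the shape of gen4's `WeilBottomExpDropOfZero`
  (`HandoffBottomGrowth.lean`, p355281; that file's `_holds` is then `:= weilBottomExpDrop_of_zero`);
* the headline equivalences UNCONDITIONALLY in this track's vocabulary: `RH ↔ ε bounded below on all windows`,
  `RH ↔ ε eventually bounded below`, `RH ↔ ∀ α > 0, ∃ C T, ∀ t ≥ T, −Ce^{2αt} ≤ ε t`;
* the lossy-tier targets WITHOUT their bridge hypothesis: `riemannHypothesis_of_bounded_loss'` (a rung with loss at a prime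
  `q₀` ∧ `StepLossy(q, δ_q)` for all primes `q ≥ q₀` ∧ bounded total loss ⟹ RH) and
  `riemannHypothesis_of_forall_handoffCouplingReg_const'` (the regularised coupling law with a FIXED loss, all large primes ⟹ RH);
* `quasiRH_of_eventually_ge_neg_exp` — the graded dictionary «growth rate `α` ⟹ zero-free half-plane `Re s > ½ + α`» in the
  tree's `QuasiRiemannHypothesis` vocabulary.

HONEST FRAMING.  Nothing here is a step towards RH: the discharged statements say what RH (or a quasi-RH) IS in
window-bottom language — «the negative part of the Weil window bottom stays bounded / grows sub-exponentially» — and the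
handoff targets they make RH-yielding (summable or power-bounded per-prime loss of the bottom) are one-sided prime-sum
bounds of RH strength (HANDOFF-STATEMENT §J.9 (3)).  The track's paper proofs (idea-1, idea-2, handoff-lit) stand as
independent arguments (prime side / Landau; zero side / Laplace–Landau; finite zero-killer) for theorems the tree proves
on the zero side by bounded power sums.

References: Bombieri, Rend. Lincei (9) 11 (2000) Thm. 1–2, §4 [Bombieri2000Weil]; Montgomery–Vaughan 2007 §15.1
[MontgomeryVaughan2007]; this track HANDOFF-STATEMENT §J; tree files named above.
-/

set_option linter.dupNamespace false  -- the mandated namespace repeats `RiemannHypothesis`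

noncomputable section

open Set Filter Literature.NumberTheory.LFunctions

namespace Summit.RiemannHypothesis.RiemannHypothesis.Theorems.HandoffDecomposition

/-! ## §1  The gen3 Props hold -/

/-- **`WeilBottomBoundedCriterion` HOLDS** («`ε` bounded below on every window ⟹ RH») — it is the tree theorem
`riemannHypothesis_iff_weilGroundEnergy_bddBelow` (Solo programme; also `GroundStatesConvergeToXi.…` of route
WeilGroundState), read through `Summit.RiemannHypothesis = RiemannHypothesis`.
[cite: Bombieri2000Weil, Thm. 1; tree SoloInformedQuasiWeilExact / WeilGroundStateGroundStatesConvergeToXiEnergyBddBelow] -/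
theorem weilBottomBoundedCriterion_holds : WeilBottomBoundedCriterion := fun h ↦
  Summit.RiemannHypothesis_iff.2 (Theorems.riemannHypothesis_iff_weilGroundEnergy_bddBelow.2 h)

/-- **LEMMA L HOLDS in the tree** (`WeilBottomDropOfOffLineZero`: a zero with `½ < Re ρ < 1` makes the window bottom
unbounded below), via `weilBottomBoundedCriterion_iff_dropOfOffLineZero`. [tree; this track (theory-1 gen4)] -/
theorem weilBottomDropOfOffLineZero_holds : WeilBottomDropOfOffLineZero :=
  weilBottomBoundedCriterion_iff_dropOfOffLineZero.1 weilBottomBoundedCriterion_holds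

/-- **GRADED LEMMA L HOLDS in the tree**, in exactly the shape of `WeilBottomExpDropOfZero` (file `HandoffBottomGrowth.lean`):
a zero `ρ` with `½ + a < Re ρ < 1` (`a ≥ 0`) forces `ε(t) < −C·e^{2at}` beyond every `T`, for every `C` — the Solo
programme's `frequently_weilGroundEnergy_lt_of_offline_zero` with rate `κ = 2a` (`κ/2 = a < Re ρ − ½ = |Re ρ − ½|`).
[tree SoloInformedQuasiWeilCriterion; this track (theory-1 gen4)] -/
theorem weilBottomExpDrop_of_zero (ρ : ℂ) (hρ : riemannZeta ρ = 0) (a : ℝ) (ha : 0 ≤ a) (h1 : 1 / 2 + a < ρ.re)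
    (h2 : ρ.re < 1) (C T : ℝ) : ∃ t : ℝ, T ≤ t ∧ weilGroundEnergy t < -C * Real.exp (2 * a * t) := by
  have hmem : ρ ∈ ZetaZeros.riemannZetaNontrivialZeros :=
    ZetaZeros.riemannZetaNontrivialZeros.mem_iff'.2 ⟨hρ, by linarith, h2⟩
  have hlt : 2 * a / 2 < |ρ.re - 1 / 2| := by
    rw [abs_of_pos (by linarith)]; linarith
  have hfr := Theorems.frequently_weilGroundEnergy_lt_of_offline_zero hmem (by positivity : (0 : ℝ) ≤ 2 * a) hlt C
  obtain ⟨t, ht, hlt'⟩ := Filter.frequently_atTop.1 hfr T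
  refine ⟨t, ht, ?_⟩
  have e : -(C * Real.exp (2 * a * t)) = -C * Real.exp (2 * a * t) := by ring
  rwa [e] at hlt'

/-! ## §2  The headline equivalences, unconditionally, in this track's vocabulary -/

/-- **`RH ↔` the Weil window bottom is bounded below on every window.** [cite: Bombieri2000Weil, Thm. 1–2; tree] -/
theorem riemannHypothesis_iff_bddBelow_weilGroundEnergy :
    Summit.RiemannHypothesis ↔ ∃ C : ℝ, ∀ t : ℝ, 0 < t → -C ≤ weilGroundEnergy t :=
  riemannHypothesis_iff_bddBelow_of_dropOfOffLineZero weilBottomDropOfOffLineZero_holds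

/-- **`RH ↔` the bottom is EVENTUALLY bounded below** (only the tail of the windows matters; `ε` antitone). [tree; this track] -/
theorem riemannHypothesis_iff_eventually_ge_weilGroundEnergy :
    Summit.RiemannHypothesis ↔ ∃ C T : ℝ, ∀ t : ℝ, T ≤ t → -C ≤ weilGroundEnergy t :=
  riemannHypothesis_iff_eventually_ge_of_dropOfOffLineZero weilBottomDropOfOffLineZero_holds

/-- **`RH ↔` the negative part of the bottom grows SUB-EXPONENTIALLY**: `RH ↔ ∀ α > 0, ∃ C T, ∀ t ≥ T, −C·e^{2αt} ≤ ε(t)`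
(the Solo programme's `riemannHypothesis_iff_weilGroundEnergy_subexp`, rate `κ = 2α`, thresholded form).
[tree SoloInformedQuasiWeilCriterion; this track (theory-1 gen4)] -/
theorem riemannHypothesis_iff_forall_eventually_ge_neg_exp :
    Summit.RiemannHypothesis ↔
      ∀ α : ℝ, 0 < α → ∃ C T : ℝ, ∀ t : ℝ, T ≤ t → -C * Real.exp (2 * α * t) ≤ weilGroundEnergy t := by
  constructor
  · intro hRH α _
    obtain ⟨C, hC⟩ := riemannHypothesis_iff_bddBelow_weilGroundEnergy.1 hRH
    refine ⟨max C 0, 1, fun t ht ↦ ?_⟩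
    have ht0 : 0 < t := lt_of_lt_of_le one_pos ht
    have h1 : (1 : ℝ) ≤ Real.exp (2 * α * t) := Real.one_le_exp (by positivity)
    have h2 : 0 ≤ max C 0 * (Real.exp (2 * α * t) - 1) := mul_nonneg (le_max_right C 0) (by linarith)
    have h3 := hC t ht0
    nlinarith [le_max_left C 0]
  · intro h
    refine Summit.RiemannHypothesis_iff.2 (Theorems.riemannHypothesis_of_weilGroundEnergy_subexp fun κ hκ ↦ ?_)
    obtain ⟨C, T, hCT⟩ := h (κ / 2) (by positivity)
    refine ⟨C, T, fun a ha ↦ ?_⟩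
    have := hCT a ha
    have e : 2 * (κ / 2) * a = κ * a := by ring
    rw [e] at this
    linarith

/-- **The graded dictionary, «⟹» half, unconditionally**: growth rate `α ≥ 0` of the negative part of the bottom beyond some
window (`∀ t ≥ T, −C·e^{2αt} ≤ ε t`) gives the zero-free half-plane `Re s > ½ + α` (`QuasiRiemannHypothesis (½ + α)` of
`GeneralizedRH.lean`).  The Solo programme's `riemannZeta_ne_zero_of_weilGroundEnergy_exp_lower`, re-keyed.
[tree SoloInformedQuasiWeilCriterion; this track (theory-1 gen4)] -/
theorem quasiRiemannHypothesis_of_eventually_ge_neg_exp {α C T : ℝ} (hα : 0 ≤ α)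
    (h : ∀ t : ℝ, T ≤ t → -C * Real.exp (2 * α * t) ≤ weilGroundEnergy t) :
    QuasiRiemannHypothesis (1 / 2 + α) := by
  intro s hs h1 h2
  obtain ⟨t, ht, hlt⟩ := weilBottomExpDrop_of_zero s hs α hα h1 h2 C T
  exact absurd (h t ht) (not_le.2 hlt)

/-! ## §3  The lossy-tier handoff targets, bridge hypothesis discharged -/

/-- **BOUNDED TOTAL LOSS ⟹ RH, unconditionally in its bridge**: a rung with loss `ℓ₀ ≥ 0` at a prime `q₀`
(`ε((log q₀)/2) ≥ −ℓ₀`), lossy increments `StepLossy(q, δ_q)` (`δ ≥ 0`) at all primes `q ≥ q₀`, and bounded partial loss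
sums `Σ_{p prime, q₀ ≤ p < Q} δ_p ≤ D` imply RH.  File II's `riemannHypothesis_of_bounded_loss` with
`WeilBottomBoundedCriterion` supplied by the tree.  (What is NOT claimed: an RH-free mechanism for a summable loss —
HANDOFF-STATEMENT §J.3/§J.9.) [this track (theory-1 gen4); tree] -/
theorem riemannHypothesis_of_bounded_loss' {δ : ℕ → ℝ} {q₀ : ℕ} {ℓ₀ D : ℝ} (hq₀ : q₀.Prime) (hℓ₀ : 0 ≤ ℓ₀)
    (hδ : ∀ q : ℕ, q.Prime → 0 ≤ δ q) (hr : -ℓ₀ ≤ weilGroundEnergy (Real.log q₀ / 2))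
    (h : ∀ q : ℕ, q.Prime → q₀ ≤ q → HandoffStepLossy q (δ q))
    (hD : ∀ Q : ℕ, ∑ p ∈ (Finset.Ico q₀ Q).filter Nat.Prime, δ p ≤ D) : Summit.RiemannHypothesis :=
  riemannHypothesis_of_bounded_loss weilBottomBoundedCriterion_holds hq₀ hℓ₀ hδ hr h hD

/-- **FIXED-LOSS REGULARISED COUPLING LAW ⟹ RH, unconditionally in its bridge**: `CouplingReg(q, q⁺, η_q, ℓ)` with a
fixed loss `ℓ ≥ 0` for all primes `q ≥ q₀` implies RH.  File I's conditional theorem with the criterion supplied by the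
tree. [this track (theory-1 gen4); tree] -/
theorem riemannHypothesis_of_forall_handoffCouplingReg_const' {η : ℕ → ℝ} {ℓ : ℝ} {q₀ : ℕ}
    (hη : ∀ q : ℕ, q.Prime → 0 ≤ η q) (hℓ : 0 ≤ ℓ)
    (h : ∀ q : ℕ, q.Prime → q₀ ≤ q → HandoffCouplingReg q (nextPrime q) (η q) ℓ) : Summit.RiemannHypothesis :=
  riemannHypothesis_of_forall_handoffCouplingReg_const weilBottomBoundedCriterion_holds hη hℓ h

/-- **No middle ground, in this track's words**: either every handoff window is Weil-positive (`H(q)` for all primes — RH),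
or the window bottom drops below `−C·e^{κt}` on arbitrarily large windows for some rate `κ > 0` and every `C`.
The Solo programme's `weilGroundEnergy_dichotomy`, first disjunct re-read by `riemannHypothesis_iff_forall_prime_handoffH`-type
bookkeeping (`H(q) ↔ 0 ≤ ε((log q⁺)/2)`). [tree SoloInformedQuasiWeilExact; this track (theory-1 gen4)] -/
theorem handoff_dichotomy :
    (∀ q : ℕ, q.Prime → HandoffH q) ∨
      ∃ κ : ℝ, 0 < κ ∧ ∀ C : ℝ, ∃ᶠ t in atTop, weilGroundEnergy t < -(C * Real.exp (κ * t)) := by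
  rcases Theorems.weilGroundEnergy_dichotomy with h | h
  · refine Or.inl fun q hq ↦ (handoffH_iff_weilPositivityOn hq).2 ?_
    have ht : 0 < Real.log (nextPrime q) / 2 := by
      have := Real.log_pos (show (1 : ℝ) < nextPrime q by exact_mod_cast (nextPrime_prime q).one_lt)
      positivity
    exact (weilGroundEnergy_nonneg_iff_holds ht).1 (h _ ht)
  · exact Or.inr h

end Summit.RiemannHypothesis.RiemannHypothesis.Theorems.HandoffDecomposition

end
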